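import Literature.AlgebraicGeometry.AbelianSchemes.HomFactorsThroughMulNLocus
import Literature.AlgebraicGeometry.AbelianSchemes.AbelianSchemeQuotientIsoOfKernelRank
import HarnessLib

/-!
# Descent of a homomorphism through an arbitrary flat surjective homomorphism, and recognition of the quotient by degree
([MumfordAV1970] §7 Thm. 4; [SGA1] Exp. VIII Thm. 5.2)

Topic `Literature/AlgebraicGeometry/AbelianSchemes`, namespace `Literature.AlgebraicGeometry.AbelianSchemes.AbelianSchemeOver`.  THEOREMS ONLY (no
definition, no named fact, no instance, no notation, no `sorry`).  Cell `pub/hodgecm-mathlib` (D-0151 ∕ D-0183 floor 0), P6 «MOD programme», sub-line P6c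
«DICT» organ **(o-c3k)** (desk F0P6c-plan 14:42:53Z): ★ `HomFactorsThroughMulNLocus.existsUnique_pow_id_comp_eq_of_forall_pow_eq_one` ∕ ★
`HomDescentMulNOfNeZero` with the isogeny `[N]` REPLACED by an ARBITRARY homomorphism `ψ : A → C` whose underlying map is flat, surjective and
quasi-compact, plus the RECOGNITION of `C` by degree (the road of ★ `AbelianSchemeQuotientIsoOfKernelRank`, (o-c3h)).  Consumers: GEN's `transl` ∕ `hecke`
(c1) (the `[ϖ]`-type isogeny `𝒜 → 𝒜 ⊗_𝒪 𝔴⁻¹` with NON-constant kernel `𝒜[𝔴]`), HEART (c3b) ∕ (c3c) («an isogeny killing `𝒜[𝔴]` of degree `q²` IS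
`transl`»); it subsumes (o-c3h) for non-constant kernels.  Generic, count-neutral capital `--supports stmt-HodgeConjecture-24832`.  HONEST LABEL:
HC_CM is proved only modulo the printed citations until rung 0 closes; this file pays no letter.

Setting: `S` ANY scheme; `A B C : AbelianSchemeOver S`; `ψ : A.X ⟶ C.X` and `φ : A.X ⟶ B.X` homomorphisms (`IsMonHom`); the KILL hypothesis
`hker : ∀ T (t : T ⟶ A.X), t ≫ ψ = 1 → t ≫ φ = 1` («`φ` kills `ker ψ`» on `T`-valued points, `T` any `S`-scheme).  No commutativity is needed.

* §1 DESCENT: `comp_eq_comp_of_forall_comp_eq_one` (`φ.left` coequalises the kernel pair of `ψ.left`: `a ≫ ψ = b ≫ ψ ⇒ (a/b) ≫ ψ = 1 ⇒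
  (a/b) ≫ φ = 1 ⇒ a ≫ φ = b ≫ φ`); **`existsUnique_comp_eq_of_forall_comp_eq_one`** — for `ψ.left` flat, surjective, quasi-compact (an
  effective epimorphism of schemes, Mathlib's fpqc instance): `∃! χ : C.X ⟶ B.X, ψ ≫ χ = φ`; `isMonHom_of_comp_eq` (★
  `isMonHom_of_comp_of_flat_surjective`); the package `exists_isMonHom_comp_eq_of_forall_comp_eq_one`; converse `comp_eq_one_of_comp_eq`.
* §2 RECOGNITION **`isIso_of_comp_eq_of_finrank_eq`** — if `ψ ≫ χ = φ` with `ψ.left` finite flat surjective of constant rank `d` and `φ.left`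
  finite flat of the same constant rank `d`, then `χ` is an ISOMORPHISM (`χ.left` is flat — `ψ` faithfully flat —, proper with finite fibres hence
  finite, and `d = rk φ = d · rk χ` with `d ≥ 1` at the unit point, so `rk χ = 1`).
* §3 **`exists_iso_comp_eq_of_forall_comp_eq_one`** — «two isogenies out of `A`, one killing the other's kernel, of equal degree, are isomorphic
  under `A`, uniquely»: `∃ e : C.X ≅ B.X, ψ ≫ e.hom = φ ∧ IsMonHom e.hom ∧ (unique)`; and then each kills the other's kernel
  (`comp_eq_one_iff_of_iso_comp_eq`).

## References
* [MumfordAV1970] D. Mumford, *Abelian Varieties* (1970), §7 Thm. 4 (p. 72) (an isogeny killing `ker ψ` factors uniquely through `ψ`, by a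
  homomorphism; one-one correspondence finite subgroups ↔ isogenies).
* [SGA1] A. Grothendieck, *SGA 1*, Exp. VIII Thm. 5.2 (fpqc descent of morphisms: a faithfully flat quasi-compact morphism is an effective
  epimorphism).
* [MumfordFogartyKirwan1994] D. Mumford, J. Fogarty, F. Kirwan, *GIT* (3rd ed.), Ch. 6 §2 Prop. 6.11 (p. 122; proof pp. 122–123) (the `[N]` case).
* [GortzWedhorn2023] U. Görtz, T. Wedhorn, *Algebraic Geometry II* (2023), Cor. 27.177 (isogenies are finite locally free; degrees multiply).
-/

noncomputable section

universe u

open CategoryTheory CategoryTheory.Limits AlgebraicGeometry MonoidalCategory CartesianMonoidalCategory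
open scoped MonObj

namespace Literature.AlgebraicGeometry.AbelianSchemes

namespace AbelianSchemeOver

variable {S : Scheme.{u}} (A : AbelianSchemeOver S) {B C : AbelianSchemeOver S} (ψ : A.X ⟶ C.X) (φ : A.X ⟶ B.X)

/-! ## §1 Descent of a homomorphism through a flat surjective quasi-compact homomorphism -/

section Descent

variable [IsMonHom ψ] [IsMonHom φ]

/-- **`φ` coequalises the kernel pair of `ψ` when it kills `ker ψ`**: for `a b : Z ⟶ A` with `a ≫ ψ = b ≫ ψ`, `(a / b) ≫ ψ = 1`, so
`(a / b) ≫ φ = 1`, i.e. `a ≫ φ = b ≫ φ` (the ★ `comp_eq_comp_of_comp_pow_id_eq` pattern with `[N]` replaced by `ψ`).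
[cite: MumfordAV1970, §7 Thm. 4 (p. 72)] [cite: MumfordFogartyKirwan1994, Ch. 6 §2 Prop. 6.11 (p. 122; proof pp. 122–123)] -/
theorem comp_eq_comp_of_forall_comp_eq_one (hker : ∀ ⦃T : Over S⦄ (t : T ⟶ A.X), t ≫ ψ = 1 → t ≫ φ = 1)
    {Z : Scheme.{u}} (a b : Z ⟶ A.X.left) (hab : a ≫ ψ.left = b ≫ ψ.left) : a ≫ φ.left = b ≫ φ.left := by
  have hb : b ≫ A.X.hom = a ≫ A.X.hom := by rw [← Over.w ψ, ← Category.assoc, ← hab, Category.assoc]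
  let Z' : Over S := Over.mk (a ≫ A.X.hom)
  let a' : Z' ⟶ A.X := Over.homMk a rfl
  let b' : Z' ⟶ A.X := Over.homMk b hb
  have hab' : a' ≫ ψ = b' ≫ ψ := Over.OverMorphism.ext hab
  have hdiv : (a' / b') ≫ ψ = 1 := by rw [GrpObj.div_comp, div_eq_one]; exact hab'
  have hkill := hker (a' / b') hdiv
  rw [GrpObj.div_comp, div_eq_one] at hkill
  exact congrArg Over.Hom.left hkill

/-- **DESCENT THROUGH A FLAT SURJECTIVE QUASI-COMPACT HOMOMORPHISM** ([MumfordAV1970] §7 Thm. 4; [SGA1] VIII 5.2): over ANY base, a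
homomorphism `φ : A → B` killing `ker ψ` on points factors UNIQUELY through the homomorphism `ψ : A → C` as soon as `ψ.left` is flat,
surjective and quasi-compact (e.g. an isogeny): `∃! χ, ψ ≫ χ = φ` — `ψ.left` is an effective epimorphism of schemes (Mathlib's fpqc
instance) and `φ.left` coequalises its kernel pair (`comp_eq_comp_of_forall_comp_eq_one`).
[cite: MumfordAV1970, §7 Thm. 4 (p. 72)] [cite: SGA1, Exp. VIII Thm. 5.2] -/
theorem existsUnique_comp_eq_of_forall_comp_eq_one [Flat ψ.left] [Surjective ψ.left] [QuasiCompact ψ.left]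
    (hker : ∀ ⦃T : Over S⦄ (t : T ⟶ A.X), t ≫ ψ = 1 → t ≫ φ = 1) :
    ∃! χ : C.X ⟶ B.X, ψ ≫ χ = φ := by
  have hco : ∀ {Z : Scheme.{u}} (a b : Z ⟶ A.X.left), a ≫ ψ.left = b ≫ ψ.left → a ≫ φ.left = b ≫ φ.left :=
    fun a b hab => A.comp_eq_comp_of_forall_comp_eq_one ψ φ hker a b hab
  let χ₀ : C.X.left ⟶ B.X.left := EffectiveEpi.desc ψ.left φ.left hco
  have hχ₀ : ψ.left ≫ χ₀ = φ.left := EffectiveEpi.fac _ _ _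
  have hw : χ₀ ≫ B.X.hom = C.X.hom := by
    rw [← cancel_epi ψ.left, ← Category.assoc, hχ₀, Over.w, Over.w]
  refine ⟨Over.homMk χ₀ hw, Over.OverMorphism.ext hχ₀, fun χ' hχ' => Over.OverMorphism.ext ?_⟩
  have hχ'' : ψ ≫ χ' = φ := hχ'
  change χ'.left = χ₀
  rw [← cancel_epi ψ.left, hχ₀, ← Over.comp_left, hχ'']

/-- **The factorisation `χ` of `φ = ψ ≫ χ` is a homomorphism** (★ `isMonHom_of_comp_of_flat_surjective`; [MumfordAV1970] §7 Thm. 4: the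
factorisation through an isogeny is a homomorphism). [cite: MumfordAV1970, §7 Thm. 4 (p. 72)] -/
theorem isMonHom_of_comp_eq [Flat ψ.left] [Surjective ψ.left] {χ : C.X ⟶ B.X} (hχ : ψ ≫ χ = φ) : IsMonHom χ :=
  isMonHom_of_comp_of_flat_surjective ψ χ (by rw [hχ]; infer_instance)

/-- Descent through `ψ` with the homomorphism clause packaged: `∃ χ, IsMonHom χ ∧ ψ ≫ χ = φ`, and any two factorisations agree.
[cite: MumfordAV1970, §7 Thm. 4 (p. 72)] [cite: SGA1, Exp. VIII Thm. 5.2] -/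
theorem exists_isMonHom_comp_eq_of_forall_comp_eq_one [Flat ψ.left] [Surjective ψ.left] [QuasiCompact ψ.left]
    (hker : ∀ ⦃T : Over S⦄ (t : T ⟶ A.X), t ≫ ψ = 1 → t ≫ φ = 1) :
    ∃ χ : C.X ⟶ B.X, IsMonHom χ ∧ ψ ≫ χ = φ ∧ ∀ χ' : C.X ⟶ B.X, ψ ≫ χ' = φ → χ' = χ := by
  obtain ⟨χ, hχ, huniq⟩ := A.existsUnique_comp_eq_of_forall_comp_eq_one ψ φ hker
  exact ⟨χ, A.isMonHom_of_comp_eq ψ φ hχ, hχ, huniq⟩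

end Descent

/-- Conversely, if `φ = ψ ≫ χ` with `χ` a homomorphism then `φ` kills `ker ψ` (no hypothesis on `ψ`). [cite: MumfordAV1970, §7 Thm. 4 (p. 72)] -/
theorem comp_eq_one_of_comp_eq {χ : C.X ⟶ B.X} [IsMonHom χ] (hχ : ψ ≫ χ = φ) {T : Over S} (t : T ⟶ A.X) (ht : t ≫ ψ = 1) :
    t ≫ φ = 1 := by
  rw [← hχ, ← Category.assoc, ht, MonObj.one_comp]

/-! ## §2 Recognition of the quotient by degree -/

/-- **RECOGNITION BY DEGREE** ([MumfordAV1970] §7 Thm. 4 + degrees, the road of ★ (o-c3h) `isIso_homDesc_of_finrank_eq_natCard`): if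
`ψ ≫ χ = φ` where `ψ.left` is finite, flat, surjective of constant rank `d` and `φ.left` is finite flat of the same constant rank `d`, then
`χ` is an ISOMORPHISM.  (`χ.left` is flat since `ψ.left` is faithfully flat and `ψ ≫ χ` is flat; proper — `C → S` proper, `B` separated over
`S` — with finite fibres `⊆ ψ(φ⁻¹ b)`, hence finite; ranks multiply, `d = d · rk χ`, and `d ≥ 1` at a unit point; so `rk χ = 1`.)
[cite: MumfordAV1970, §7 Thm. 4 (p. 72)] [cite: GortzWedhorn2023, Cor. 27.177] -/
theorem isIso_of_comp_eq_of_finrank_eq {χ : C.X ⟶ B.X} (hχ : ψ ≫ χ = φ) [IsFinite ψ.left] [Flat ψ.left] [Surjective ψ.left]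
    [IsFinite φ.left] [Flat φ.left] (d : ℕ) (hdψ : ∀ c : C.left, ψ.left.finrank c = d) (hdφ : ∀ b : B.left, φ.left.finrank b = d) :
    IsIso χ := by
  haveI := B.isProper
  haveI := C.isProper
  have hl : ψ.left ≫ χ.left = φ.left := by rw [← Over.comp_left, hχ]
  -- `χ.left` is flat
  haveI : Flat (ψ.left ≫ χ.left) := by rw [hl]; infer_instance
  haveI : Flat χ.left := Morphisms.Flat.of_comp_of_surjective ψ.left χ.left
  -- `χ.left` is proper with finite fibres, hence finite
  haveI : IsProper (χ.left ≫ B.X.hom) := by rw [Over.w χ]; infer_instance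
  haveI : IsProper χ.left := IsProper.of_comp χ.left B.X.hom
  haveI : LocallyQuasiFinite χ.left :=
    LocallyQuasiFinite.of_finite_preimage_singleton _
      (finite_preimage_singleton_of_comp ψ.left χ.left φ.left hl ψ.left.surjective
        (fun b => φ.left.finite_preimage_singleton b))
  haveI : IsFinite χ.left := IsFinite.of_isProper_of_locallyQuasiFinite _
  -- ranks multiply along `ψ ≫ χ = φ`
  have h1 : ∀ b : B.left, χ.left.finrank b = 1 := fun b => by
    have hm := Morphisms.finrank_comp_eq_mul ψ.left χ.left b d (fun y _ => hdψ y)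
    rw [hl, hdφ b] at hm
    have hd : d ≠ 0 := by
      have h1 := φ.left.one_le_finrank_map (A.unitSection.base (B.X.hom.base b))
      rw [hdφ] at h1
      omega
    exact (mul_eq_left₀ hd).mp hm.symm
  haveI : IsIso ((Over.forget S).map χ) := (Scheme.Hom.isIso_iff_finrank_eq χ.left).mpr (funext h1)
  exact isIso_of_reflects_iso χ (Over.forget S)

/-! ## §3 Two isogenies of equal degree, one killing the other's kernel, are isomorphic under `A` -/

/-- **UNIQUENESS OF THE QUOTIENT BY DEGREE** ([MumfordAV1970] §7 Thm. 4): `ψ : A → C`, `φ : A → B` homomorphisms with `ψ.left` finite flat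
surjective of constant rank `d`, `φ.left` finite flat of constant rank `d`, and `φ` killing `ker ψ` on points; THEN there is an isomorphism
`e : C ≅ B` in `Over S` with `ψ ≫ e = φ`, it is a homomorphism, and it is the unique factorisation.
[cite: MumfordAV1970, §7 Thm. 4 (p. 72)] [cite: SGA1, Exp. VIII Thm. 5.2] [cite: GortzWedhorn2023, Cor. 27.177] -/
theorem exists_iso_comp_eq_of_forall_comp_eq_one [IsMonHom ψ] [IsMonHom φ] [IsFinite ψ.left] [Flat ψ.left] [Surjective ψ.left]
    [IsFinite φ.left] [Flat φ.left] (hker : ∀ ⦃T : Over S⦄ (t : T ⟶ A.X), t ≫ ψ = 1 → t ≫ φ = 1)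
    (d : ℕ) (hdψ : ∀ c : C.left, ψ.left.finrank c = d) (hdφ : ∀ b : B.left, φ.left.finrank b = d) :
    ∃ e : C.X ≅ B.X, ψ ≫ e.hom = φ ∧ IsMonHom e.hom ∧ ∀ χ : C.X ⟶ B.X, ψ ≫ χ = φ → χ = e.hom := by
  obtain ⟨χ, hχ, huniq⟩ := A.existsUnique_comp_eq_of_forall_comp_eq_one ψ φ hker
  haveI := A.isIso_of_comp_eq_of_finrank_eq ψ φ hχ d hdψ hdφ
  exact ⟨asIso χ, hχ, A.isMonHom_of_comp_eq ψ φ hχ, fun χ' h' => huniq χ' h'⟩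

/-- … and then EACH kills the other's kernel: if `ψ ≫ e.hom = φ` with `e` an isomorphism and a homomorphism, `t ≫ ψ = 1 ↔ t ≫ φ = 1`.
[cite: MumfordAV1970, §7 Thm. 4 (p. 72)] -/
theorem comp_eq_one_iff_of_iso_comp_eq (e : C.X ≅ B.X) [IsMonHom e.hom] (he : ψ ≫ e.hom = φ) {T : Over S} (t : T ⟶ A.X) :
    t ≫ ψ = 1 ↔ t ≫ φ = 1 := by
  refine ⟨fun ht => A.comp_eq_one_of_comp_eq ψ φ he t ht, fun ht => ?_⟩
  rw [← cancel_mono e.hom, Category.assoc, he, ht, MonObj.one_comp]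

end AbelianSchemeOver

end Literature.AlgebraicGeometry.AbelianSchemes

end
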